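/-
Copyright (c) 2026 the pub-hodgecm-mathlib formalisation cell (harness21).  Prover seat hodgecm-mathlib-K2E3-p28 (g4) (S6 hand under dealer R90-C14-plan (g2)),
card (G2) «TYPE-(2) DISCHARGE», FILE 2 = the VALUES edition: the RECORD target (E2) at every displacement `m` from ONE named anchor (U1₂) (census
`K2/K2E3-p28/g4/G2-DISCHARGE-CENSUS.md` 368559be56a7517e §5 item 2).  THEOREMS ONLY (no `def`, no `instance`, no notation, no `sorry`); ONE named hypothesis `hU1`
(the level-one anchor, whose odd-class special count (G2-ODD) C is not yet in the tree); lane `--supports stmt-HodgeConjecture-24833 --as helper` (count-neutral helper).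
-/
import Summits.HodgeConjecture.HodgeConjecture.Theorems.R90S6EllipticIdentityTypeTwoReduction        -- FILE 1b (this seat): `delta_mul_kappaDiff_ncard_displaced_typeTwo_eq_sum_xiHCoeff_mul_ncard_displaced_two_of_unitLevels`
import Summits.HodgeConjecture.HodgeConjecture.Theorems.R90S6TreeFixDataTypeTwoU2Shells               -- ★ HF2 p864775 (p07) `ncard_fixed_modular_eq_sum_of_typeTwoCorner`; brings ★ HF2 FILE 1 p864578 `ncard_fixed_selfDual_eq_sum_of_typeTwoCorner`
import Summits.HodgeConjecture.HodgeConjecture.Theorems.R90S6TorusFixedHyperspecialCountTypeTwoOdd    -- ★ (G2-ODD) A p864978 (p07) `natCard_fixedPoints_unitaryInt_eq_phiTHprimen_of_eigen_odd` (odd class, all depths)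
import Literature.NumberTheory.Rogawski1990.UnitOrbitalIntegralInertValueTHEigen                     -- ★ a₀ `natCard_fixedPoints_unitaryInt_eq_phiTHn_of_eigen` (even class, all depths); brings ★ `v_disc_and_v_eval_of_ramifiedTorus`, ★ `v_sq_sub_mul_sq_eq_max`, ★ `map_mul_self_eq_one_of_mulVec_eq_smul`
import Literature.NumberTheory.Rogawski1990.UnitFundamentalLemmaInertFlickerAlgebraTypeTwo             -- ★ `Flicker1998.flicker_theorem18n_halg` (Theorem 18 in the observable exponents), `phiHtwo`
import Literature.NumberTheory.Automorphic.UnitaryFixedCosetsStableLattices                           -- ★ `unitaryInt_eq_glInt_subgroupOf` (`U(𝒪) = K₀`: ★ a₀'s quotient = GF1's)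
import Literature.NumberTheory.Automorphic.ValuedFieldValuativeRelBridge                              -- ★ `valuedInteger_eq_integer`, `finite_residueField_of_compatible`, `natCard_residueField_eq_of_compatible` (the `Valued` ∕ `ValuativeRel` dictionary)
import HarnessLib

/-!
# R90 · S6 — row E1.3.5.2.6, card (G2) FILE 2: THE RAMIFIED TYPE-(2) ELLIPTIC κ-IDENTITY (E2) IN VALUES, FROM THE ONE ANCHOR (U1₂)
# (`Theorems/R90S6EllipticIdentityTypeTwo.lean`)

Cell `hodgecm-mathlib`, crux H413 (`stmt-HodgeConjecture-24833`), route of record `HCCMUnconditional`; programme R90-TF, section S6 (base `R90-C14`, dealer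
R90-C14-plan (g2)), seat K2E3-p28 (g4); card **(G2) «TYPE-(2) DISCHARGE»**, RECORD target (E2) = typ1 sheet v2.3 `4c174fca74d7a58a` :468
`delta_mul_kappaDiff_ncard_displaced_typeTwo_eq_sum_xiHCoeff_mul_ncard_displaced_two` ([BR₁] Thm. 1 = Rogawski Prop. 4.9.1 (b) for the ramified anisotropic torus
`T ≃ E¹ × Res M¹`; Flicker 1998 Theorem 18 at `m = 0`).

THE MATHEMATICS.  FILE 1b reduced (E2) at every `m` to the two unit-level anchors (U0₂) `Δ·(V₀(γ₁) − V₀(γ₂)) = P`, (U1₂) `Δ·(V₁(γ₁) − V₁(γ₂)) = P − 1` and the two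
H-side fixed counts `F₀(δ) = F₁(δ) = P`.  This file PAYS everything but (U1₂) from ★ organs, in the RECORD head's own letters:
* `P = Σ_{k ≤ N} q^k` and `F₀(δ) = F₁(δ) = P` — ★ HF2 `ncard_fixed_selfDual_eq_sum_of_typeTwoCorner` ∕ `ncard_fixed_modular_eq_sum_of_typeTwoCorner` at the corner
  `δ = t_H = (A Cρ; C A)`, after carrying the residual frame `(hσO, a₀, #𝓀 = q²)` from the `Valued` currency of the head to the `ValuativeRel` currency of the rank-one tree
  (★ `valuedInteger_eq_integer`: the two valuation rings coincide; §1);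
* `Δ = (−q)^{log|(u−A)² − C²ρ|} = (−q)^{−n}` (`hχ`), and the EXPONENT LAW `n ≤ 2N + 1 ∧ (n even ∨ n = 2N + 1)` (§1: `|(u−A)² − ρC²| = max(|u−A|², |ϖ|·|C|²)`, the
  two valuations never coincide — ★ `v_sq_sub_mul_sq_eq_max`);
* `V₀(γ₁) = phiTHn q n N` — ★ a₀ `natCard_fixedPoints_unitaryInt_eq_phiTHn_of_eigen` at the literal `γ₁ = (A 0 Cρ; 0 u 0; C 0 A)` with its EVEN eigenvector `e₁`
  (`B₀(e₁,e₁) = 1`), `tr γ₁ = 2A + u`, `det γ₁ = u(A² − C²ρ)` (★ `v_disc_and_v_eval_of_ramifiedTorus`), over the v2.3 frame letters VERBATIM (`y cW um R ι σR dR ϖR hqR a₀`,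
  completeness); `V₀(γ₂) = phiTHprimen q n N` — ★ (G2-ODD) A at the intrinsic odd letters `hγ₂x hx₂ hN₂ hn₂` VERBATIM; `U(𝒪) = K₀` by ★ `unitaryInt_eq_glInt_subgroupOf`;
* (U0₂) = Flicker's THEOREM 18: `(−q)^{−n}·(phiTHn − phiTHprimen) = Φ_H(N) = (q^{N+1} − 1)∕(q − 1) = P` (★ `flicker_theorem18n_halg` + Mathlib `geom_sum_eq`).
HEAD `…_of_unitLevelOne`: (E2) :468's conclusion BYTES VERBATIM at every `m`, binders = v2.3's own minus `hn2 hN1 x₀ hx₀` (nothing here needs the deep regime or the H-side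
root) plus the ONE named anchor `hU1 : Δ·(V₁(γ₁) − V₁(γ₂)) = Σ_{k≤N} q^k − 1` — Theorem 18 one level down: ★ (R2) `natCard_fixedBy_special_add_phiTHn_eq_of_typeTwo` (even,
deep) and its odd twin (G2-ODD) C (p07, not yet ★) in the deep regime, K2Liu-p14's «E2♭-COUNT» rows in the shallow one.  Because ★ a₀ and ★ (G2-ODD) A hold at EVERY depth,
this head serves (E2) AND (E2♭) alike.
HONEST LABEL: (E2) for all `m` modulo ONE named hypothesis (U1₂); proves no printed global statement by itself, discharges no citation, count-neutral until E1.3.5.2 ∕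
E1.3.9 consume it.  HC_CM is proved only modulo the 7 printed citations (2 remaining named inputs: hLiu418 = stmt-HodgeConjecture-24832, h413 =
stmt-HodgeConjecture-24833) until rung 0 closes.

## References
* [Rogawski1990] J. D. Rogawski, *Automorphic Representations of Unitary Groups in Three Variables*, Ann. of Math. Stud. 123 (1990), §4.9 Prop. 4.9.1 (b) pp. 54–55;
  §3.6 Lemma 3.6.1 p. 28.
* [Flicker1998UnitaryFL] Y. Z. Flicker, *Elementary proof of the fundamental lemma for a unitary group*, Canad. J. Math. 50 (1998), Prop. 6 p. 83, Prop. 11 p. 87,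
  Props. 16–17 pp. 96–97, Theorem 18 p. 97.
* [Kottwitz1986BaseChangeUnits] R. E. Kottwitz, *Base change for unit elements of Hecke algebras*, Compositio Math. 60 (1986), §1 pp. 240–241.
* [Serre1979] J.-P. Serre, *Local Fields*, GTM 67 (1979), Ch. II §1 (one valuation ring).  [LabesseLanglands1979] J.-P. Labesse, R. P. Langlands, Canad. J. Math. 31 (1979), §§2–3.
-/

set_option autoImplicit false
-- the mandated namespace repeats the single-problem summit's segment (`HodgeConjecture.HodgeConjecture`)
set_option linter.dupNamespace false

noncomputable section

open MulAction Finset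
open scoped Valued WithZero Matrix MatrixGroups
open Literature.NumberTheory.Automorphic Literature.NumberTheory.Automorphic.HermitianLattice Literature.NumberTheory.Automorphic.UnitaryGroup
open Literature.NumberTheory.Automorphic.UnitaryLatticeTree (unitaryInt_eq_glInt_subgroupOf)
open Literature.NumberTheory.Rogawski1990.Flicker1998 (phiTHn phiTHprimen phiHtwo flicker_theorem18n_halg)
open IsLocalRing

namespace Summit.HodgeConjecture.HodgeConjecture.R90.S6

universe u

variable {K : Type} [Field K] [Valued K ℤᵐ⁰] [ValuativeRel K] [(Valued.v : Valuation K ℤᵐ⁰).Compatible] {σ : K →+* K} {ϖ : K}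

/-! ## §1 Letters: the exponent law, `log|χ| = −n`, `Φ_H(N) = Σ_{k≤N} q^k`, `1 < q`, and the H-side fixed counts in the head's currency -/

omit [ValuativeRel K] [(Valued.v : Valuation K ℤᵐ⁰).Compatible] in
/-- **THE EXPONENT LAW of the type-(2) letters**: `|ρ| = |ϖ|`, `|C| = |ϖ^N|`, `|(u−A)² − C²ρ| = |ϖ^n|` force `n ≤ 2N + 1` and (`n` even or `n = 2N + 1`) — the valuations
`|u−A|²` (even) and `|ρ|·|C|²` (odd) never coincide (★ `v_sq_sub_mul_sq_eq_max`), so `|ϖ^n|` is their maximum. [cite: Flicker1998UnitaryFL, Prop. 6 p. 83; Theorem 18 p. 97] -/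
theorem typeTwo_exponent_law (hd : HermitianLattice.LocalConjDatum σ ϖ) {A C ρ u : K} (hvρ : Valued.v ρ = Valued.v ϖ) {N n : ℕ}
    (hvC : Valued.v C = Valued.v (ϖ ^ N)) (hχ : Valued.v ((u - A) ^ 2 - C ^ 2 * ρ) = Valued.v (ϖ ^ n)) :
    n ≤ 2 * N + 1 ∧ (Even n ∨ n = 2 * N + 1) := by
  have hvpow : ∀ j : ℕ, Valued.v (ϖ ^ j) = WithZero.exp (-(j : ℤ)) := fun j => by
    rw [map_pow, hd.vϖ, ← WithZero.exp_nsmul, nsmul_eq_mul, mul_neg, mul_one]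
  have hvρ' : Valued.v ρ = WithZero.exp (-1 : ℤ) := by rw [hvρ, hd.vϖ]
  have h2 : WithZero.exp (-1 : ℤ) * Valued.v C ^ 2 = WithZero.exp (-((2 * N + 1 : ℕ) : ℤ)) := by
    rw [hvC, hvpow, pow_two, ← WithZero.exp_add, ← WithZero.exp_add]
    congr 1
    push_cast
    ring
  have hmax : WithZero.exp (-(n : ℤ)) = max (Valued.v (u - A) ^ 2) (WithZero.exp (-((2 * N + 1 : ℕ) : ℤ))) := by
    rw [← hvpow n, ← hχ, show (u - A) ^ 2 - C ^ 2 * ρ = (u - A) ^ 2 - ρ * C ^ 2 by ring, v_sq_sub_mul_sq_eq_max hvρ', h2]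
  by_cases h0 : Valued.v (u - A) = 0
  · rw [h0, zero_pow two_ne_zero, max_eq_right zero_le, WithZero.exp_inj] at hmax
    push_cast at hmax
    exact ⟨by omega, Or.inr (by omega)⟩
  · rw [← WithZero.exp_log h0, ← WithZero.exp_nsmul, nsmul_eq_mul, Nat.cast_ofNat] at hmax
    rcases le_total (WithZero.exp (2 * WithZero.log (Valued.v (u - A))) : ℤᵐ⁰) (WithZero.exp (-((2 * N + 1 : ℕ) : ℤ))) with hab | hab
    · rw [max_eq_right hab, WithZero.exp_inj] at hmax
      rw [WithZero.exp_le_exp] at hab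
      push_cast at hmax hab
      exact ⟨by omega, Or.inr (by omega)⟩
    · rw [max_eq_left hab, WithZero.exp_inj] at hmax
      rw [WithZero.exp_le_exp] at hab
      push_cast at hmax hab
      refine ⟨by omega, Or.inl ?_⟩
      have he : (n : ℤ) = 2 * (-WithZero.log (Valued.v (u - A))) := by omega
      rw [← Int.even_coe_nat, he]
      exact even_two_mul _

omit [ValuativeRel K] [(Valued.v : Valuation K ℤᵐ⁰).Compatible] in
/-- `log|(u−A)² − C²ρ| = −n` under the datum (`|ϖ^n| = exp(−n)`): the exponent of `Δ = (−q)^{log|χ₂(u)|}`. [cite: Flicker1998UnitaryFL, Theorem 18 p. 97] -/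
theorem log_v_typeTwo_eq_neg (hd : HermitianLattice.LocalConjDatum σ ϖ) {A C ρ u : K} {n : ℕ}
    (hχ : Valued.v ((u - A) ^ 2 - C ^ 2 * ρ) = Valued.v (ϖ ^ n)) :
    WithZero.log (Valued.v ((u - A) ^ 2 - C ^ 2 * ρ)) = -(n : ℤ) := by
  rw [hχ, map_pow, hd.vϖ, ← WithZero.exp_nsmul, nsmul_eq_mul, mul_neg, mul_one, WithZero.log_exp]

/-- `Φ_H(N) = (q^{N+1} − 1)∕(q − 1) = Σ_{k ≤ N} q^k` as complex numbers (`1 < q`; Mathlib `geom_sum_eq`). [cite: Flicker1998UnitaryFL, Theorem 18 p. 97] -/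
theorem phiHtwo_cast_eq_sum {q : ℕ} (hq1 : 1 < q) (N : ℕ) :
    ((phiHtwo q N : ℚ) : ℂ) = ((∑ k ∈ Finset.range (N + 1), q ^ k : ℕ) : ℂ) := by
  have hq1' : (q : ℚ) ≠ 1 := by exact_mod_cast hq1.ne'
  rw [phiHtwo, ← geom_sum_eq hq1' (N + 1)]
  push_cast
  rfl

omit [ValuativeRel K] [(Valued.v : Valuation K ℤᵐ⁰).Compatible] in
/-- `1 < q` when the residue field (a field, hence with at least two elements) has `q²` elements. [cite: Serre1979, Ch. II §1] -/
theorem one_lt_of_card_residueField_eq_sq [Fintype 𝓀[K]] {q : ℕ} (hq : Fintype.card 𝓀[K] = q ^ 2) : 1 < q := by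
  have h : 1 < q ^ 2 := hq ▸ Fintype.one_lt_card
  exact (Nat.pow_lt_pow_iff_left two_ne_zero).1 (by rwa [one_pow])

/-- **THE TWO H-SIDE FIXED COUNTS IN THE HEAD'S CURRENCY**: `F₀(δ) = F₁(δ) = Σ_{k ≤ N} q^k` for the corner `δ = (A Cρ; C A) ∈ U₂` — ★ HF2's two counts, whose residual
frame `(σO, a₀, #𝓀 = q²)` lives on the `ValuativeRel` valuation ring of the rank-one tree, fed from the RECORD head's `Valued` letters `hσO, a₀, [Fintype 𝓀], hq` through
★ `valuedInteger_eq_integer` (ONE valuation ring, two spellings). [cite: Flicker1998UnitaryFL, §6 p. 97] [cite: Kottwitz1988, §2] [cite: Serre1979, Ch. II §1] -/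
theorem ncard_fixed_eq_sum_of_typeTwoCorner_valued (hd : HermitianLattice.LocalConjDatum σ ϖ)
    (hσO : ∀ x : 𝒪[K], σ x ∈ 𝒪[K]) [Fintype 𝓀[K]] {q : ℕ} (hq : Fintype.card 𝓀[K] = q ^ 2)
    {a₀ : 𝒪[K]} (ha₀ : IsUnit (((σ.comp 𝒪[K].subtype).codRestrict 𝒪[K] hσO) a₀ - a₀))
    {δ : ↥(unitaryGroupOfForm σ ((StdForm.antidiagonal 2).over K))} {A C ρ : K}
    (hδ : ((δ : GL (Fin 2) K) : Matrix (Fin 2) (Fin 2) K) = !![A, C * ρ; C, A])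
    (hvρ : Valued.v ρ = Valued.v ϖ) {N : ℕ} (hvC : Valued.v C = Valued.v (ϖ ^ N)) :
    {x : {M : Submodule (ValuativeRel.valuation K).integer (Fin 2 → K) // HermitianLatticeTree.IsSpecialLattice σ ϖ ((StdForm.antidiagonal 2).over K) M} |
        HermitianLatticeTree.IsSelfDualLattice σ ((StdForm.antidiagonal 2).over K) x.1 ∧
          HermitianLatticeTree.latticeTreeIso σ ϖ ((StdForm.antidiagonal 2).over K) δ x = x}.ncard = ∑ k ∈ Finset.range (N + 1), q ^ k ∧
      {x : {M : Submodule (ValuativeRel.valuation K).integer (Fin 2 → K) // HermitianLatticeTree.IsSpecialLattice σ ϖ ((StdForm.antidiagonal 2).over K) M} |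
        HermitianLatticeTree.IsModularLattice σ ϖ ((StdForm.antidiagonal 2).over K) x.1 ∧
          HermitianLatticeTree.latticeTreeIso σ ϖ ((StdForm.antidiagonal 2).over K) δ x = x}.ncard = ∑ k ∈ Finset.range (N + 1), q ^ k := by
  -- one valuation ring, two spellings
  have hOO : Valued.integer K = (ValuativeRel.valuation K).integer := valuedInteger_eq_integer
  set e : ↥(Valued.integer K) ≃+* ↥(ValuativeRel.valuation K).integer := RingEquiv.subringCongr hOO with he
  set σO' : ↥(ValuativeRel.valuation K).integer →+* ↥(ValuativeRel.valuation K).integer :=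
    (e.toRingHom.comp ((σ.comp 𝒪[K].subtype).codRestrict 𝒪[K] hσO)).comp e.symm.toRingHom with hσO'def
  have hσO'' : ∀ x : ↥(ValuativeRel.valuation K).integer, ((σO' x : ↥(ValuativeRel.valuation K).integer) : K) = σ x := fun x => rfl
  have ha₀' : IsUnit (σO' (e a₀) - e a₀) := by
    have h := ha₀.map e
    rw [map_sub] at h
    have hs : σO' (e a₀) = e (((σ.comp 𝒪[K].subtype).codRestrict 𝒪[K] hσO) a₀) := by
      show e (((σ.comp 𝒪[K].subtype).codRestrict 𝒪[K] hσO) (e.symm (e a₀))) = _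
      rw [e.symm_apply_apply]
    rwa [hs]
  haveI : Finite (IsLocalRing.ResidueField ↥(ValuativeRel.valuation K).integer) := finite_residueField_of_compatible
  have hq' : Nat.card (IsLocalRing.ResidueField ↥(ValuativeRel.valuation K).integer) = q ^ 2 := by
    rw [natCard_residueField_eq_of_compatible, Nat.card_eq_fintype_card]; exact hq
  exact ⟨ncard_fixed_selfDual_eq_sum_of_typeTwoCorner hd σO' hσO'' ha₀' hq' hδ hvρ hvC,
    ncard_fixed_modular_eq_sum_of_typeTwoCorner hd σO' hσO'' ha₀' hq' hδ hvρ hvC⟩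

/-! ## §2 The unit anchor (U0₂) in values: Flicker's Theorem 18 over ★ a₀ (even class) and ★ (G2-ODD) A (odd class) -/

/-- **(U0₂) PAID**: for the literal even class `γ₁ = (A 0 Cρ; 0 u 0; C 0 A)` and any odd-class `γ₂` with the same exponent letters `(N, n)` at `u`,
`(−q)^{log|(u−A)² − C²ρ|} · (#Fix_{γ₁}(U₃ ⧸ K₀) − #Fix_{γ₂}(U₃ ⧸ K₀)) = Σ_{k ≤ N} q^k` — ★ a₀ (`phiTHn q n N`), ★ (G2-ODD) A (`phiTHprimen q n N`), the exponent law (§1) and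
★ `flicker_theorem18n_halg` (`(−q)^{−n}·(Φ − Φ′) = Φ_H(N)`), `Φ_H(N) = Σ_{k≤N} q^k`.  Frame letters = the RECORD head's v2.3 block VERBATIM.
[cite: Flicker1998UnitaryFL, Theorem 18 p. 97; Prop. 11 p. 87; Props. 16–17 pp. 96–97] [cite: Rogawski1990, §4.9 Prop. 4.9.1 (b) p. 55] [cite: Kottwitz1986BaseChangeUnits, §1 pp. 240–241] -/
theorem delta_mul_natCard_fixedBy_sub_eq_sum_of_typeTwo (hd : HermitianLattice.LocalConjDatum σ ϖ)
    (hσO : ∀ x : 𝒪[K], σ x ∈ 𝒪[K]) [Fintype 𝓀[K]] {q : ℕ} (hq : Fintype.card 𝓀[K] = q ^ 2)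
    {A C ρ u : K} (hvρ : Valued.v ρ = Valued.v ϖ) {N n : ℕ} (hvC : Valued.v C = Valued.v (ϖ ^ N))
    (hχ : Valued.v ((u - A) ^ 2 - C ^ 2 * ρ) = Valued.v (ϖ ^ n))
    (γ₁ : unitaryGroupOfForm σ ((StdForm.antidiagonal 3).over K))
    (hγ₁ : ((γ₁ : GL (Fin 3) K) : Matrix (Fin 3) (Fin 3) K) = !![A, 0, C * ρ; 0, u, 0; C, 0, A])
    (γ₂ : unitaryGroupOfForm σ ((StdForm.antidiagonal 3).over K))
    {x₂ : Fin 3 → K} (hγ₂x : ((γ₂ : GL (Fin 3) K) : Matrix (Fin 3) (Fin 3) K) *ᵥ x₂ = u • x₂)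
    {k₂ : ℤ} (hx₂ : Valued.v (HermitianLattice.B₀ σ 3 x₂ x₂) = WithZero.exp (2 * k₂ + 1))
    (hN₂ : Valued.v ((Matrix.trace ((γ₂ : GL (Fin 3) K) : Matrix (Fin 3) (Fin 3) K) - u) ^ 2 -
      4 * (Matrix.det ((γ₂ : GL (Fin 3) K) : Matrix (Fin 3) (Fin 3) K) / u)) = Valued.v (ϖ ^ (2 * N + 1)))
    (hn₂ : Valued.v (u ^ 2 - (Matrix.trace ((γ₂ : GL (Fin 3) K) : Matrix (Fin 3) (Fin 3) K) - u) * u +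
      Matrix.det ((γ₂ : GL (Fin 3) K) : Matrix (Fin 3) (Fin 3) K) / u) = Valued.v (ϖ ^ n))
    [IsDiscreteValuationRing 𝒪[K]] [IsAdicComplete (IsLocalRing.maximalIdeal 𝒪[K]) 𝒪[K]]
    {y : K} (hy : y * σ y = -2)
    {cW : ↥(unitaryGroupOfForm σ ((StdForm.antidiagonal 3).over K))} (hcW : ((cW : GL (Fin 3) K) : Matrix (Fin 3) (Fin 3) K) = !![1, 0, 0; 0, -1, 0; 0, 0, 1])
    (um : ℕ → ↥(unitaryGroupOfForm σ ((StdForm.antidiagonal 3).over K)))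
    (hum : ∀ m, ((um m : GL (Fin 3) K) : Matrix (Fin 3) (Fin 3) K) = !![ϖ ^ m, y, (ϖ ^ m)⁻¹; 0, 1, -σ y * (ϖ ^ m)⁻¹; 0, 0, (ϖ ^ m)⁻¹])
    {R : Type} [CommRing R] [IsDomain R] [IsDiscreteValuationRing R] [Finite (IsLocalRing.ResidueField R)] [IsAdicComplete (IsLocalRing.maximalIdeal R) R]
    (ι : R →+* K) (hι : Function.Injective ι)
    (hιv : ∀ x : K, Valued.v x ≤ 1 ↔ x ∈ Set.range ι) (σR : R →+* R) (hσR : ∀ r, σR (σR r) = r) (hσι : ∀ r, ι (σR r) = σ (ι r))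
    {dR : R} (hdRσ : σR dR = -dR) (hdRu : IsUnit dR) (h2R : IsUnit (2 : R)) {ϖR : R} (hϖR : Irreducible ϖR) (hιϖ : ι ϖR = ϖ)
    (hqR : Nat.card (IsLocalRing.ResidueField R) = q ^ 2)
    {a₀ : 𝒪[K]} (ha₀ : IsUnit (((σ.comp 𝒪[K].subtype).codRestrict 𝒪[K] hσO) a₀ - a₀))
    (hfin₀₁ : (fixedBy (↥(unitaryGroupOfForm σ ((StdForm.antidiagonal 3).over K)) ⧸
      (glInt 3 K).subgroupOf (unitaryGroupOfForm σ ((StdForm.antidiagonal 3).over K))) γ₁).Finite) :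
    (-(q : ℂ)) ^ WithZero.log (Valued.v ((u - A) ^ 2 - C ^ 2 * ρ)) *
        ((Nat.card (fixedBy (↥(unitaryGroupOfForm σ ((StdForm.antidiagonal 3).over K)) ⧸
            (glInt 3 K).subgroupOf (unitaryGroupOfForm σ ((StdForm.antidiagonal 3).over K))) γ₁) : ℂ) -
          (Nat.card (fixedBy (↥(unitaryGroupOfForm σ ((StdForm.antidiagonal 3).over K)) ⧸
            (glInt 3 K).subgroupOf (unitaryGroupOfForm σ ((StdForm.antidiagonal 3).over K))) γ₂) : ℂ)) =
      ((∑ k ∈ Finset.range (N + 1), q ^ k : ℕ) : ℂ) := by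
  have hq1 : 1 < q := one_lt_of_card_residueField_eq_sq hq
  have hqNat : Nat.card (IsLocalRing.ResidueField 𝒪[K]) = q ^ 2 := by rw [Nat.card_eq_fintype_card]; exact hq
  have hlaw := typeTwo_exponent_law hd hvρ hvC hχ
  -- the even class: ★ a₀ at the literal with its eigenvector `e₁`
  have htx₁ : ((γ₁ : GL (Fin 3) K) : Matrix (Fin 3) (Fin 3) K) *ᵥ Pi.single 1 1 = u • Pi.single 1 1 := by
    rw [hγ₁]; ext i; fin_cases i <;> simp [Matrix.mulVec, dotProduct, Pi.single_apply]
  have hx₁ : Valued.v (HermitianLattice.B₀ σ 3 (Pi.single 1 (1 : K)) (Pi.single 1 1)) = WithZero.exp (2 * (0 : ℤ)) := by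
    rw [HermitianLattice.B₀_single_left, show Fin.rev (1 : Fin 3) = 1 from rfl, Pi.single_eq_same, map_one, mul_zero, WithZero.exp_zero]
  have hB0₁ : HermitianLattice.B₀ σ 3 (Pi.single 1 (1 : K)) (Pi.single 1 1) ≠ 0 := fun h0 => by
    rw [h0, map_zero] at hx₁; exact WithZero.coe_ne_zero hx₁.symm
  have hu1 : σ u * u = 1 := map_mul_self_eq_one_of_mulVec_eq_smul σ rfl γ₁ htx₁ hB0₁
  have hu0 : u ≠ 0 := fun h0 => by rw [h0, mul_zero] at hu1; exact zero_ne_one hu1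
  have htr₁ : Matrix.trace ((γ₁ : GL (Fin 3) K) : Matrix (Fin 3) (Fin 3) K) = 2 * A + u := by
    rw [hγ₁]
    simp [Matrix.trace_fin_three]
    ring
  have hdet₁ : Matrix.det ((γ₁ : GL (Fin 3) K) : Matrix (Fin 3) (Fin 3) K) = u * (A ^ 2 - C ^ 2 * ρ) := by
    rw [hγ₁]
    simp [Matrix.det_fin_three]
    ring
  obtain ⟨hdisc₁, heval₁⟩ := v_disc_and_v_eval_of_ramifiedTorus σ hd hu0 hvρ htr₁ hdet₁
  have hvρ' : Valued.v ρ = WithZero.exp (-1 : ℤ) := by rw [hvρ, hd.vϖ]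
  have hN₁ : Valued.v ((Matrix.trace ((γ₁ : GL (Fin 3) K) : Matrix (Fin 3) (Fin 3) K) - u) ^ 2 -
      4 * (Matrix.det ((γ₁ : GL (Fin 3) K) : Matrix (Fin 3) (Fin 3) K) / u)) = Valued.v (ϖ ^ (2 * N + 1)) := by
    rw [hdisc₁, hvC, ← map_pow, ← map_mul]; congr 1; ring
  have hn₁ : Valued.v (u ^ 2 - (Matrix.trace ((γ₁ : GL (Fin 3) K) : Matrix (Fin 3) (Fin 3) K) - u) * u +
      Matrix.det ((γ₁ : GL (Fin 3) K) : Matrix (Fin 3) (Fin 3) K) / u) = Valued.v (ϖ ^ n) := by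
    rw [heval₁, ← hχ, show (u - A) ^ 2 - C ^ 2 * ρ = (u - A) ^ 2 - ρ * C ^ 2 by ring, v_sq_sub_mul_sq_eq_max hvρ', hd.vϖ]
  have hfinK₁ : {z : ↥(unitaryGroupOfForm σ ((StdForm.antidiagonal 3).over K)) ⧸ unitaryInt σ ((StdForm.antidiagonal 3).over K) | γ₁ • z = z}.Finite := by
    rw [unitaryInt_eq_glInt_subgroupOf]; exact hfin₀₁
  have hV₀₁ := natCard_fixedPoints_unitaryInt_eq_phiTHn_of_eigen σ rfl hd hσO hy hcW um hum ι hι hιv σR hσR hσι hdRσ hdRu h2R hϖR hιϖ hqNat hqR hq1 ha₀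
    htx₁ hx₁ hN₁ hn₁ hfinK₁
  rw [unitaryInt_eq_glInt_subgroupOf] at hV₀₁
  change (Nat.card (fixedBy (↥(unitaryGroupOfForm σ ((StdForm.antidiagonal 3).over K)) ⧸
      (glInt 3 K).subgroupOf (unitaryGroupOfForm σ ((StdForm.antidiagonal 3).over K))) γ₁) : ℚ) = phiTHn q n N at hV₀₁
  -- the odd class: ★ (G2-ODD) A (all depths, intrinsic letters)
  have hV₀₂ := natCard_fixedPoints_unitaryInt_eq_phiTHprimen_of_eigen_odd σ rfl hd hσO hqNat hq1 ha₀ hγ₂x hx₂ hN₂ hn₂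
  rw [unitaryInt_eq_glInt_subgroupOf] at hV₀₂
  change (Nat.card (fixedBy (↥(unitaryGroupOfForm σ ((StdForm.antidiagonal 3).over K)) ⧸
      (glInt 3 K).subgroupOf (unitaryGroupOfForm σ ((StdForm.antidiagonal 3).over K))) γ₂) : ℚ) = phiTHprimen q n N at hV₀₂
  -- Theorem 18
  have e1 : ((Nat.card (fixedBy (↥(unitaryGroupOfForm σ ((StdForm.antidiagonal 3).over K)) ⧸
      (glInt 3 K).subgroupOf (unitaryGroupOfForm σ ((StdForm.antidiagonal 3).over K))) γ₁) : ℕ) : ℂ) = ((phiTHn q n N : ℚ) : ℂ) := by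
    rw [← hV₀₁]; norm_cast
  have e2 : ((Nat.card (fixedBy (↥(unitaryGroupOfForm σ ((StdForm.antidiagonal 3).over K)) ⧸
      (glInt 3 K).subgroupOf (unitaryGroupOfForm σ ((StdForm.antidiagonal 3).over K))) γ₂) : ℕ) : ℂ) = ((phiTHprimen q n N : ℚ) : ℂ) := by
    rw [← hV₀₂]; norm_cast
  rw [log_v_typeTwo_eq_neg hd hχ, e1, e2, ← phiHtwo_cast_eq_sum hq1 N]
  exact flicker_theorem18n_halg hq1 hlaw.1 hlaw.2

/-! ## §3 HEAD: (E2) at every displacement from the ONE anchor (U1₂) -/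

/-- **(G2) THE RAMIFIED TYPE-(2) ELLIPTIC κ-IDENTITY (E2) AT EVERY `m`, FROM THE LEVEL-ONE ANCHOR ALONE.**  Binders = the RECORD head typ1 v2.3 :468's own, VERBATIM and
in its order, minus `hn2 hN1 x₀ hx₀` (unused: every organ below holds at all depths and ★ HF2's counts are root-free), plus ONE named hypothesis
**(U1₂) `hU1 : (−q)^{log|(u−A)² − C²ρ|}·(#Fix_{γ₁}(U₃ ⧸ K₁) − #Fix_{γ₂}(U₃ ⧸ K₁)) = Σ_{k≤N} q^k − 1`** (Flicker's Theorem 18 one level down: ★ (R2) + (G2-ODD) C in the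
deep regime, the «E2♭-COUNT» rows in the shallow one); conclusion = :468's conclusion BYTES VERBATIM.  Proof: FILE 1b ∘ §1 (`P = Σ_{k≤N} q^k`, `F₀(δ) = F₁(δ) = P` ★ HF2) ∘
§2 ((U0₂) = Theorem 18).  Serves (E2) (`2 ≤ n`) and (E2♭) (`n ≤ 1`) alike.
[cite: Rogawski1990, §4.9 Prop. 4.9.1 (b) pp. 54–55; §3.6 Lemma 3.6.1 p. 28] [cite: Flicker1998UnitaryFL, Theorem 18 p. 97; Prop. 11 p. 87; Props. 16–17 pp. 96–97]
[cite: Kottwitz1986BaseChangeUnits, §1 pp. 240–241] [cite: LabesseLanglands1979, §§2–3] -/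
theorem delta_mul_kappaDiff_ncard_displaced_typeTwo_eq_sum_xiHCoeff_mul_ncard_displaced_two_of_unitLevelOne
    (hd : HermitianLattice.LocalConjDatum σ ϖ)
    (hσO : ∀ x : 𝒪[K], σ x ∈ 𝒪[K]) (σk : 𝓀[K] →+* 𝓀[K])
    (hσk : ∀ x : 𝒪[K], IsLocalRing.residue 𝒪[K] ⟨σ x, hσO x⟩ = σk (IsLocalRing.residue 𝒪[K] x))
    [Fintype 𝓀[K]] {q : ℕ} (hq : Fintype.card 𝓀[K] = q ^ 2) (hfrob : ∀ y, σk y = y ^ q)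
    {A C ρ u : K} (hvρ : Valued.v ρ = Valued.v ϖ) {N n : ℕ} (hvC : Valued.v C = Valued.v (ϖ ^ N))
    (hχ : Valued.v ((u - A) ^ 2 - C ^ 2 * ρ) = Valued.v (ϖ ^ n))
    (γ₁ : unitaryGroupOfForm σ ((StdForm.antidiagonal 3).over K))
    (hγ₁ : ((γ₁ : GL (Fin 3) K) : Matrix (Fin 3) (Fin 3) K) = !![A, 0, C * ρ; 0, u, 0; C, 0, A])
    (γ₂ : unitaryGroupOfForm σ ((StdForm.antidiagonal 3).over K))
    {x₂ : Fin 3 → K} (hγ₂x : ((γ₂ : GL (Fin 3) K) : Matrix (Fin 3) (Fin 3) K) *ᵥ x₂ = u • x₂)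
    {k₂ : ℤ} (hx₂ : Valued.v (HermitianLattice.B₀ σ 3 x₂ x₂) = WithZero.exp (2 * k₂ + 1))
    (hN₂ : Valued.v ((Matrix.trace ((γ₂ : GL (Fin 3) K) : Matrix (Fin 3) (Fin 3) K) - u) ^ 2 -
      4 * (Matrix.det ((γ₂ : GL (Fin 3) K) : Matrix (Fin 3) (Fin 3) K) / u)) = Valued.v (ϖ ^ (2 * N + 1)))
    (hn₂ : Valued.v (u ^ 2 - (Matrix.trace ((γ₂ : GL (Fin 3) K) : Matrix (Fin 3) (Fin 3) K) - u) * u +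
      Matrix.det ((γ₂ : GL (Fin 3) K) : Matrix (Fin 3) (Fin 3) K) / u) = Valued.v (ϖ ^ n))
    (δ : unitaryGroupOfForm σ ((StdForm.antidiagonal 2).over K))
    (hδ : ((δ : GL (Fin 2) K) : Matrix (Fin 2) (Fin 2) K) = !![A, C * ρ; C, A])
    [IsDiscreteValuationRing 𝒪[K]] [IsAdicComplete (IsLocalRing.maximalIdeal 𝒪[K]) 𝒪[K]]
    {y : K} (hy : y * σ y = -2)
    {cW : ↥(unitaryGroupOfForm σ ((StdForm.antidiagonal 3).over K))} (hcW : ((cW : GL (Fin 3) K) : Matrix (Fin 3) (Fin 3) K) = !![1, 0, 0; 0, -1, 0; 0, 0, 1])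
    (um : ℕ → ↥(unitaryGroupOfForm σ ((StdForm.antidiagonal 3).over K)))
    (hum : ∀ m, ((um m : GL (Fin 3) K) : Matrix (Fin 3) (Fin 3) K) = !![ϖ ^ m, y, (ϖ ^ m)⁻¹; 0, 1, -σ y * (ϖ ^ m)⁻¹; 0, 0, (ϖ ^ m)⁻¹])
    {R : Type} [CommRing R] [IsDomain R] [IsDiscreteValuationRing R] [Finite (IsLocalRing.ResidueField R)] [IsAdicComplete (IsLocalRing.maximalIdeal R) R]
    (ι : R →+* K) (hι : Function.Injective ι)
    (hιv : ∀ x : K, Valued.v x ≤ 1 ↔ x ∈ Set.range ι) (σR : R →+* R) (hσR : ∀ r, σR (σR r) = r) (hσι : ∀ r, ι (σR r) = σ (ι r))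
    {dR : R} (hdRσ : σR dR = -dR) (hdRu : IsUnit dR) (h2R : IsUnit (2 : R)) {ϖR : R} (hϖR : Irreducible ϖR) (hιϖ : ι ϖR = ϖ)
    (hqR : Nat.card (IsLocalRing.ResidueField R) = q ^ 2)
    {a₀ : 𝒪[K]} (ha₀ : IsUnit (((σ.comp 𝒪[K].subtype).codRestrict 𝒪[K] hσO) a₀ - a₀))
    (g₁ : GL (Fin 3) K) (hg₁ : (g₁ : Matrix (Fin 3) (Fin 3) K) = Matrix.diagonal ![(1 : K), 1, ϖ])
    (hfin₀₁ : (fixedBy (↥(unitaryGroupOfForm σ ((StdForm.antidiagonal 3).over K)) ⧸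
      (glInt 3 K).subgroupOf (unitaryGroupOfForm σ ((StdForm.antidiagonal 3).over K))) γ₁).Finite)
    (hfin₁₁ : (fixedBy (↥(unitaryGroupOfForm σ ((StdForm.antidiagonal 3).over K)) ⧸
      ((glInt 3 K).map (MulAut.conj g₁).toMonoidHom).subgroupOf (unitaryGroupOfForm σ ((StdForm.antidiagonal 3).over K))) γ₁).Finite)
    (horb₁ : (Set.range fun n : ℕ => ((γ₁ ^ n : ↥(unitaryGroupOfForm σ ((StdForm.antidiagonal 3).over K))) :
      ↥(unitaryGroupOfForm σ ((StdForm.antidiagonal 3).over K)) ⧸ (glInt 3 K).subgroupOf (unitaryGroupOfForm σ ((StdForm.antidiagonal 3).over K)))).Finite)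
    (hfin₀₂ : (fixedBy (↥(unitaryGroupOfForm σ ((StdForm.antidiagonal 3).over K)) ⧸
      (glInt 3 K).subgroupOf (unitaryGroupOfForm σ ((StdForm.antidiagonal 3).over K))) γ₂).Finite)
    (hfin₁₂ : (fixedBy (↥(unitaryGroupOfForm σ ((StdForm.antidiagonal 3).over K)) ⧸
      ((glInt 3 K).map (MulAut.conj g₁).toMonoidHom).subgroupOf (unitaryGroupOfForm σ ((StdForm.antidiagonal 3).over K))) γ₂).Finite)
    (horb₂ : (Set.range fun n : ℕ => ((γ₂ ^ n : ↥(unitaryGroupOfForm σ ((StdForm.antidiagonal 3).over K))) :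
      ↥(unitaryGroupOfForm σ ((StdForm.antidiagonal 3).over K)) ⧸ (glInt 3 K).subgroupOf (unitaryGroupOfForm σ ((StdForm.antidiagonal 3).over K)))).Finite)
    (hloc : ∀ v, ((HermitianLatticeTree.latticeTree σ ϖ ((StdForm.antidiagonal 2).over K)).neighborSet v).Finite)
    (hreg : ∀ v, ((HermitianLatticeTree.latticeTree σ ϖ ((StdForm.antidiagonal 2).over K)).neighborSet v).ncard = q + 1)
    -- the ONE named anchor (U1₂): Theorem 18 one level down (★ (R2) + (G2-ODD) C deep; «E2♭-COUNT» shallow)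
    (hU1 : (-(q : ℂ)) ^ WithZero.log (Valued.v ((u - A) ^ 2 - C ^ 2 * ρ)) *
        ((Nat.card (fixedBy (↥(unitaryGroupOfForm σ ((StdForm.antidiagonal 3).over K)) ⧸
            ((glInt 3 K).map (MulAut.conj g₁).toMonoidHom).subgroupOf (unitaryGroupOfForm σ ((StdForm.antidiagonal 3).over K))) γ₁) : ℂ) -
          (Nat.card (fixedBy (↥(unitaryGroupOfForm σ ((StdForm.antidiagonal 3).over K)) ⧸
            ((glInt 3 K).map (MulAut.conj g₁).toMonoidHom).subgroupOf (unitaryGroupOfForm σ ((StdForm.antidiagonal 3).over K))) γ₂) : ℂ)) =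
      ((∑ k ∈ Finset.range (N + 1), q ^ k : ℕ) : ℂ) - 1)
    (m : ℕ) :
    (-(q : ℂ)) ^ WithZero.log (Valued.v ((u - A) ^ 2 - C ^ 2 * ρ)) *
        (({x : {M : Submodule 𝒪[K] (Fin 3 → K) // UnitaryLatticeTree.IsVertex σ ϖ ((StdForm.antidiagonal 3).over K) M} |
              UnitaryLatticeTree.IsSelfDualLattice σ ϖ ((StdForm.antidiagonal 3).over K) x.1 ∧
                (UnitaryLatticeTree.latticeGraph σ ϖ ((StdForm.antidiagonal 3).over K)).dist x
                  (UnitaryLatticeTree.latticeGraphPerm σ ϖ ((StdForm.antidiagonal 3).over K) γ₁ x) = 2 * m}.ncard : ℂ) -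
          ({x : {M : Submodule 𝒪[K] (Fin 3 → K) // UnitaryLatticeTree.IsVertex σ ϖ ((StdForm.antidiagonal 3).over K) M} |
              UnitaryLatticeTree.IsSelfDualLattice σ ϖ ((StdForm.antidiagonal 3).over K) x.1 ∧
                (UnitaryLatticeTree.latticeGraph σ ϖ ((StdForm.antidiagonal 3).over K)).dist x
                  (UnitaryLatticeTree.latticeGraphPerm σ ϖ ((StdForm.antidiagonal 3).over K) γ₂ x) = 2 * m}.ncard : ℂ)) =
      ∑ k ∈ Finset.range (m + 1), xiHCoeff q m k *
          ({x : {M : Submodule (ValuativeRel.valuation K).integer (Fin 2 → K) // HermitianLatticeTree.IsSpecialLattice σ ϖ ((StdForm.antidiagonal 2).over K) M} |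
              HermitianLatticeTree.IsSelfDualLattice σ ((StdForm.antidiagonal 2).over K) x.1 ∧
                (HermitianLatticeTree.latticeTree σ ϖ ((StdForm.antidiagonal 2).over K)).dist x
                  (HermitianLatticeTree.latticeTreeIso σ ϖ ((StdForm.antidiagonal 2).over K) δ x) = 2 * k}.ncard : ℂ) := by
  have hP : 1 ≤ ∑ k ∈ Finset.range (N + 1), q ^ k := by
    rw [Finset.sum_range_succ', pow_zero]; exact le_add_self
  obtain ⟨hF0, hF1⟩ := ncard_fixed_eq_sum_of_typeTwoCorner_valued hd hσO hq ha₀ hδ hvρ hvC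
  have hU0 := delta_mul_natCard_fixedBy_sub_eq_sum_of_typeTwo hd hσO hq hvρ hvC hχ γ₁ hγ₁ γ₂ hγ₂x hx₂ hN₂ hn₂ hy hcW um hum ι hι hιv σR hσR hσι hdRσ hdRu h2R
    hϖR hιϖ hqR ha₀ hfin₀₁
  exact delta_mul_kappaDiff_ncard_displaced_typeTwo_eq_sum_xiHCoeff_mul_ncard_displaced_two_of_unitLevels hd hσO σk hσk hq hfrob γ₁ γ₂ δ g₁ hg₁
    hfin₀₁ hfin₁₁ horb₁ hfin₀₂ hfin₁₂ horb₂ hloc hreg hP hF0 hF1 hU0 hU1 m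

end Summit.HodgeConjecture.HodgeConjecture.R90.S6

end
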